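import Summits.QuantumFields.YangMills.Theorems.UnitScaleTiltProp7LapDefectFirstOrder
import Summits.QuantumFields.YangMills.Theorems.UnitScaleTiltProp7CombLoopSquareCount
import HarnessLib

/-!
# Route `UnitScaleTilt`, crux K1 «MinimiserStabilityRegPr» (stmt-QuantumFields-19200), route-R E′, S3 K-form engine, ROW (H) — hLap INHABITANT, FILE C (ℤ^d comb letters):
# THE LAPLACIAN SUMMAND OF A COMB LOCAL MODEL TO FIRST ORDER, IN CANONICAL LETTERS — for the two (27)-contours at `w` and `w + e_μ` (the pair of
# ✓ `Prop7AxialLocalModel.lap_axialModel`): `2m − R(V(Γ_(0,w) ∪ μ ∪ −Γ))⁻¹m − R(V(Γ_(0,w+e_μ) ∪ μ ∪ −Γ))m = −[Σ_(k<|B|) (R(V(Γ_(0,q₁+k)))P₁(k) − R(V(Γ_(0,q₂+k)))P₂(k)), m]`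
# up to `5a·|B|`× the two canonical rung families of ✓ `Prop7CombLoopSquareCount.comm_loop_le_canonical_rungs` — the first-order term LINEAR in the canonically transported
# plaquette differences (rung `k` of the tail at `q₁ + disp(B↾k)` minus the same rung one unit back in `μ`)

Cell `ym3-torus`, width seat `ym3-torus-px4` (gen 4); ★ym-ust-19200-p1 g16 NAMER WORD 14 «px4 g4: hLap INHABITANT GO» (2026-08-29 00:17Z), road (iii) (★w4 g7 00:26Z; ★p1 (N3)
TABLE 2 00:56Z: ρ_Res ∝ ℓ² at seeds = this seat's located Hardy count, so the current must be formed BEFORE norms).  THEOREMS ONLY (0 `def`, 0 `sorry`); `--supports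
stmt-QuantumFields-19200`, count-neutral.  YM₃ on T³ is a ladder rung (R3), not the Clay problem; nothing here claims hLap, hRes, (H), S3, E′, a stub, the crux, d = 4 or the gap.

WHY.  ✓p683997 `Prop7LapDefectFirstOrder.norm_lapDefect_chain_add_comm_sum_le` is the abstract statement for two chains `g, g′` read against the SAME element.  Here it is
instantiated at the comb: both contours are conjugated ladders along the SAME tail word `B = t.flatMap (κ ↦ seg κ (w κ))` (✓ `Prop7CombLadder.hol_contour27_of_nonneg∕_of_neg`),
based at `q₁ = disp(A ++ seg μ (w μ + 1))` resp. `q₂ = q₁ − e_μ`, with prefix transports related by ONE bond, `V(A ++ seg μ (w μ)) = V(A ++ seg μ (w μ + 1))·V(q₂,μ)⁻¹`, in every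
sign case of `w μ` (§1).  Conjugating the second ladder by that bond makes the pair two chains over one base with rungs `T_kP_kT_k⁻¹`, `T″_kP″_kT″_k⁻¹`, and after conjugation by
the common prefix every transport is the COMB to the rung position (✓ `Prop7CombLoopSquareCount.hol_base_prefix_nonneg`): the canonical letters of the (Kg′) family.

WHAT IS PROVED (ns `…Theorems.Prop7LapCombFirstOrder`; `V : Site d → Fin d → 𝔸ˣ`, split `(finRange d).reverse = s ++ μ :: t`, site `w : Site d`; all words spelled out).
* §1 (any group) `hol_rung_default` (`V(μ μ μ̄ μ̄) = 1`), `hol_prefix_pred` (`V(A ++ seg μ n) = V(A ++ seg μ (n+1))·V(end − e_μ, μ)⁻¹`, both signs), ★ `hol_contour27_eq_conj_ladder`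
  (uniform conjugated-ladder form, both signs), `ladder_chain_zero`∕★ `ladder_chain_succ` (the ladder of `B↾k` as a chain in ✓ `comm_chain_le`'s format, for ALL `k : ℕ` — beyond
  `|B|` the default rung is trivial), `conj_ladder_chain_succ` (the bond-conjugated ladder is a chain with transports `β⁻¹·V_(q₂)(B↾k)`).
* §2 (normed) ★★★ `norm_lapDefect_comb_add_comm_sum_le` — the title statement.
HONEST SCOPE.  Word algebra over landed identities + one application of ✓p683997; no count, no regrouping over `μ`, no localisation (✓p683897 applies to each summand), no T³.

References: T. Bałaban, CMP 98 (1985) 17–51 [Balaban1985Averaging] ((9) pp.18–19, (19)–(20) p.21, p.24); CMP 102 (1985) 255–275 [Balaban1985UV3] ((27) p.263);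
CMP 99 (1985) 389–434 [Balaban1985BackgroundPropagators] ((3.3)–(3.4) pp.390–391, (3.8) p.392).
-/

set_option autoImplicit false

noncomputable section

open scoped BigOperators

namespace Summit.QuantumFields.YangMills.Theorems.Prop7LapCombFirstOrder

open Literature.MathematicalPhysics.QuantumFieldTheory.Balaban1983to89
open B7Prop1Explicit (Site Letter e disp revWord seg treeWord hol stepHol hol_append hol_cons hol_nil stepHol_false disp_append disp_cons disp_nil)
open B10Eq27AxialLog (contour27)
open B9Eq39Adjoint (R R_def)
open Summit.QuantumFields.YangMills.Theorems.Prop7CombLadder (hol_backtrack hol_ladder_snoc hol_rung_nil seg_succ_of_nonneg seg_of_neg flatMap_seg_add_e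
  hol_contour27_of_nonneg hol_contour27_of_neg bicontr_hol bicontr_conj)
open Summit.QuantumFields.YangMills.Theorems.Prop7CombLadderCount (disp_base_neg disp_base_nonneg)
open Summit.QuantumFields.YangMills.Theorems.Prop7CombLoopSquareCount (hol_base_prefix_nonneg)
open Summit.QuantumFields.YangMills.Theorems.Prop7ConjFrameTransport (R_finset_sum)
open Summit.QuantumFields.YangMills.Theorems.Prop7LapDefectFirstOrder (norm_lapDefect_chain_add_comm_sum_le)
open B16Txt357ThirdOrderNonAbelian (norm_R_le)

/-! ## §1 Word algebra (any group) -/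

section Group

variable {d : ℕ} {G : Type*} [Group G] (V : Site d → Fin d → G)

/-- the default rung `μ μ μ̄ μ̄` transports by `1` (two backtracks). [cite: Balaban1985Averaging, (9) p.18] -/
theorem hol_rung_default (x : Site d) (μ : Fin d) : hol V x [(μ, true), (μ, true), Letter.rev (μ, true), (μ, false)] = 1 := by
  have h1 := hol_backtrack V x [(μ, true)] [(μ, false)] (μ, true)
  have h2 := hol_backtrack V x [] [] (μ, true)
  simp only [List.cons_append, List.nil_append] at h1 h2
  rw [h1]
  simpa using h2

/-- the prefix to the PREVIOUS point of the `μ`-run is the prefix to the point, times the bond backwards — in both sign cases of the run: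
`V(A ++ seg μ n) = V(A ++ seg μ (n+1))·V(disp(A ++ seg μ (n+1)) − e_μ, μ)⁻¹`. [cite: Balaban1985Averaging, (9) p.18] -/
theorem hol_prefix_pred (A : List (Letter d)) (μ : Fin d) (n : ℤ) :
    hol V 0 (A ++ seg μ n) = hol V 0 (A ++ seg μ (n + 1)) * (V (disp (A ++ seg μ (n + 1)) - e μ) μ)⁻¹ := by
  rcases le_or_gt 0 n with hn | hn
  · have hd : disp (A ++ seg μ (n + 1)) - e μ = disp (A ++ seg μ n) := by
      rw [seg_succ_of_nonneg μ hn, ← List.append_assoc, disp_append (A ++ seg μ n) [(μ, true)], disp_cons, disp_nil, add_zero, Letter.vec_true,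
        add_sub_cancel_right]
    rw [hd, seg_succ_of_nonneg μ hn, ← List.append_assoc, hol_append V 0 (A ++ seg μ n) [(μ, true)], zero_add, hol_cons, hol_nil, mul_one,
      B7Prop1Explicit.stepHol_true, mul_inv_cancel_right]
  · rw [seg_of_neg μ hn, ← List.append_assoc, hol_append V 0 (A ++ seg μ (n + 1)) [(μ, false)], zero_add, hol_cons, hol_nil, mul_one, stepHol_false]

/-- ★ **THE COMB LOOP IS A CONJUGATED LADDER — UNIFORM FORM** (both sign cases of `v μ`): `V(Γ_(0,v) ∪ μ ∪ −Γ_(0,v+e_μ)) = 𝒯·V_q(ladder_μ B)·𝒯⁻¹` with `𝒯 = V(A ++ seg μ (v μ))`,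
`q = disp(A ++ seg μ (v μ))`, `B` the tail runs. [cite: Balaban1985UV3, (27) p.263; Balaban1985Averaging, (9) p.19] -/
theorem hol_contour27_eq_conj_ladder (v : Site d) (μ : Fin d) {s t : List (Fin d)} (h : (List.finRange d).reverse = s ++ μ :: t) (hs : μ ∉ s) (ht : μ ∉ t) :
    hol V 0 (contour27 0 v μ)
      = hol V 0 (s.flatMap (fun κ => seg κ (v κ)) ++ seg μ (v μ))
        * hol V (disp (s.flatMap (fun κ => seg κ (v κ)) ++ seg μ (v μ)))
            (t.flatMap (fun κ => seg κ (v κ)) ++ (μ, true) :: (revWord (t.flatMap (fun κ => seg κ (v κ))) ++ [(μ, false)]))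
        * (hol V 0 (s.flatMap (fun κ => seg κ (v κ)) ++ seg μ (v μ)))⁻¹ := by
  rcases le_or_gt 0 (v μ) with hv | hv
  · exact hol_contour27_of_nonneg V v μ h hs ht hv
  · rw [hol_contour27_of_neg V v μ h hs ht hv]
    have hT : hol V 0 (s.flatMap (fun κ => seg κ (v κ)) ++ seg μ (v μ + 1)) * stepHol V (disp (s.flatMap (fun κ => seg κ (v κ)) ++ seg μ (v μ + 1))) (μ, false)
        = hol V 0 (s.flatMap (fun κ => seg κ (v κ)) ++ seg μ (v μ)) := by
      rw [stepHol_false, ← hol_prefix_pred]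
    have hq : disp (s.flatMap (fun κ => seg κ (v κ)) ++ seg μ (v μ + 1)) - e μ = disp (s.flatMap (fun κ => seg κ (v κ)) ++ seg μ (v μ)) := by
      rw [disp_base_neg, disp_base_nonneg]
    rw [hT, hq]

/-- the ladder of the empty prefix is trivial. [folklore] -/
theorem ladder_chain_zero (q : Site d) (μ : Fin d) (B : List (Letter d)) :
    hol V q (B.take 0 ++ (μ, true) :: (revWord (B.take 0) ++ [(μ, false)])) = 1 := by
  rw [List.take_zero, B7Prop1Explicit.revWord_nil]; exact hol_rung_nil V q μ

/-- ★ **THE LADDER OF `B↾k` IS A CHAIN FOR EVERY `k : ℕ`**: `V(ladder_μ(B↾(k+1))) = (T_k·P_k·T_k⁻¹)·V(ladder_μ(B↾k))` with `T_k = V_q(B↾k)`, `P_k` the plaquette word of the `k`-th letter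
(default `(μ,+)` beyond `|B|`, whose plaquette is trivial — so the relation holds for all `k`, as ✓ `comm_chain_le` wants). [cite: Balaban1985Averaging, (9) pp.18-19] -/
theorem ladder_chain_succ (q : Site d) (μ : Fin d) (B : List (Letter d)) (k : ℕ) :
    hol V q (B.take (k + 1) ++ (μ, true) :: (revWord (B.take (k + 1)) ++ [(μ, false)]))
      = (hol V q (B.take k) * hol V (q + disp (B.take k)) [B.getD k (μ, true), (μ, true), (B.getD k (μ, true)).rev, (μ, false)] * (hol V q (B.take k))⁻¹)
        * hol V q (B.take k ++ (μ, true) :: (revWord (B.take k) ++ [(μ, false)])) := by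
  rcases lt_or_ge k B.length with hk | hk
  · have htake : B.take (k + 1) = B.take k ++ [B.getD k (μ, true)] := by
      rw [List.getD_eq_getElem _ _ hk, List.take_add_one, List.getElem?_eq_getElem hk]; rfl
    rw [htake]; exact hol_ladder_snoc V q μ (B.take k) (B.getD k (μ, true))
  · have ht1 : B.take (k + 1) = B.take k := by rw [List.take_of_length_le hk, List.take_of_length_le (by omega)]
    rw [ht1, List.getD_eq_default _ _ hk, hol_rung_default, mul_one, mul_inv_cancel, one_mul]

/-- the bond-conjugated ladder `β⁻¹·V_(q₂)(ladder_μ(B↾k))·β` is a chain with transports `β⁻¹·V_(q₂)(B↾k)`. [cite: Balaban1985Averaging, (9) pp.18-19] -/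
theorem conj_ladder_chain_succ (q : Site d) (μ : Fin d) (B : List (Letter d)) (β : G) (k : ℕ) :
    β⁻¹ * hol V q (B.take (k + 1) ++ (μ, true) :: (revWord (B.take (k + 1)) ++ [(μ, false)])) * β
      = ((β⁻¹ * hol V q (B.take k)) * hol V (q + disp (B.take k)) [B.getD k (μ, true), (μ, true), (B.getD k (μ, true)).rev, (μ, false)] * (β⁻¹ * hol V q (B.take k))⁻¹)
        * (β⁻¹ * hol V q (B.take k ++ (μ, true) :: (revWord (B.take k) ++ [(μ, false)])) * β) := by
  rw [ladder_chain_succ]; group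

end Group

/-! ## §2 The Laplacian summand of the comb pair to first order, canonical letters -/

section Normed

variable {d : ℕ} {𝔸 : Type*} [NormedRing 𝔸] [NormOneClass 𝔸] (V : Site d → Fin d → 𝔸ˣ)
  (hV : ∀ (x : Site d) (κ : Fin d), ‖(V x κ : 𝔸)‖ ≤ 1 ∧ ‖(((V x κ)⁻¹ : 𝔸ˣ) : 𝔸)‖ ≤ 1)

include hV in
/-- ★★★ **THE LAPLACIAN SUMMAND OF A COMB LOCAL MODEL TO FIRST ORDER, CANONICAL LETTERS.**  Split `(finRange d).reverse = s ++ μ :: t`, site `w`, tail `B = t.flatMap (κ ↦ seg κ (w κ))`,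
bases `q₁ = disp(A ++ seg μ (w μ + 1))` (the contour at `w + e_μ`) and `q₂ = disp(A ++ seg μ (w μ))` (the contour at `w`), rung `k` = the plaquette word of the `k`-th tail letter at
`q_i + disp(B↾k)`, transported along the COMB `V(Γ_(0, q_i + disp(B↾k)))`.  If every plaquette word is within `a ≥ 0` of `1`, then
`‖(2m − R(V(contour at w))⁻¹m − R(V(contour at w+e_μ))m) + [Σ_(k<|B|) (R(V(Γ_(0,q₁+k)))P₁(k) − R(V(Γ_(0,q₂+k)))P₂(k)), m]‖ ≤ 5a·|B|·(Σ_k N₁(k) + Σ_k N₂(k))`,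
`N_i(k) = ‖[P_i(k), R(V(Γ_(0,q_i+k))⁻¹)m]‖` — the canonical rung families of ✓ `comm_loop_le_canonical_rungs` at `w + e_μ` and at `w`.
[cite: Balaban1985BackgroundPropagators, (3.3)-(3.4) pp.390-391, (3.8) p.392; Balaban1985Averaging, (9) pp.18-19, (19)-(20) p.21, p.24; Balaban1985UV3, (27) p.263] -/
theorem norm_lapDefect_comb_add_comm_sum_le (μ : Fin d) {s t : List (Fin d)} (h : (List.finRange d).reverse = s ++ μ :: t) (hs : μ ∉ s) (ht : μ ∉ t)
    (w : Site d) (m : 𝔸) {a : ℝ} (ha : 0 ≤ a) (hplaq : ∀ (x : Site d) (l : Letter d), ‖((hol V x [l, (μ, true), l.rev, (μ, false)] : 𝔸ˣ) : 𝔸) - 1‖ ≤ a) :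
    ‖((2 : ℕ) • m - R (hol V 0 (contour27 0 w μ))⁻¹ m - R (hol V 0 (contour27 0 (w + e μ) μ)) m)
        + ((∑ k ∈ Finset.range (t.flatMap (fun κ => seg κ (w κ))).length,
              (R (hol V 0 (treeWord (disp (s.flatMap (fun κ => seg κ (w κ)) ++ seg μ (w μ + 1)) + disp ((t.flatMap (fun κ => seg κ (w κ))).take k))))
                  ((hol V (disp (s.flatMap (fun κ => seg κ (w κ)) ++ seg μ (w μ + 1)) + disp ((t.flatMap (fun κ => seg κ (w κ))).take k))
                    [(t.flatMap (fun κ => seg κ (w κ))).getD k (μ, true), (μ, true), ((t.flatMap (fun κ => seg κ (w κ))).getD k (μ, true)).rev, (μ, false)] : 𝔸ˣ) : 𝔸)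
              - R (hol V 0 (treeWord (disp (s.flatMap (fun κ => seg κ (w κ)) ++ seg μ (w μ)) + disp ((t.flatMap (fun κ => seg κ (w κ))).take k))))
                  ((hol V (disp (s.flatMap (fun κ => seg κ (w κ)) ++ seg μ (w μ)) + disp ((t.flatMap (fun κ => seg κ (w κ))).take k))
                    [(t.flatMap (fun κ => seg κ (w κ))).getD k (μ, true), (μ, true), ((t.flatMap (fun κ => seg κ (w κ))).getD k (μ, true)).rev, (μ, false)] : 𝔸ˣ) : 𝔸))) * m
          - m * ∑ k ∈ Finset.range (t.flatMap (fun κ => seg κ (w κ))).length,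
              (R (hol V 0 (treeWord (disp (s.flatMap (fun κ => seg κ (w κ)) ++ seg μ (w μ + 1)) + disp ((t.flatMap (fun κ => seg κ (w κ))).take k))))
                  ((hol V (disp (s.flatMap (fun κ => seg κ (w κ)) ++ seg μ (w μ + 1)) + disp ((t.flatMap (fun κ => seg κ (w κ))).take k))
                    [(t.flatMap (fun κ => seg κ (w κ))).getD k (μ, true), (μ, true), ((t.flatMap (fun κ => seg κ (w κ))).getD k (μ, true)).rev, (μ, false)] : 𝔸ˣ) : 𝔸)
              - R (hol V 0 (treeWord (disp (s.flatMap (fun κ => seg κ (w κ)) ++ seg μ (w μ)) + disp ((t.flatMap (fun κ => seg κ (w κ))).take k))))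
                  ((hol V (disp (s.flatMap (fun κ => seg κ (w κ)) ++ seg μ (w μ)) + disp ((t.flatMap (fun κ => seg κ (w κ))).take k))
                    [(t.flatMap (fun κ => seg κ (w κ))).getD k (μ, true), (μ, true), ((t.flatMap (fun κ => seg κ (w κ))).getD k (μ, true)).rev, (μ, false)] : 𝔸ˣ) : 𝔸)))‖
      ≤ 5 * a * (t.flatMap (fun κ => seg κ (w κ))).length
          * (∑ k ∈ Finset.range (t.flatMap (fun κ => seg κ (w κ))).length,
                ‖((hol V (disp (s.flatMap (fun κ => seg κ (w κ)) ++ seg μ (w μ + 1)) + disp ((t.flatMap (fun κ => seg κ (w κ))).take k))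
                      [(t.flatMap (fun κ => seg κ (w κ))).getD k (μ, true), (μ, true), ((t.flatMap (fun κ => seg κ (w κ))).getD k (μ, true)).rev, (μ, false)] : 𝔸ˣ) : 𝔸)
                    * R (hol V 0 (treeWord (disp (s.flatMap (fun κ => seg κ (w κ)) ++ seg μ (w μ + 1)) + disp ((t.flatMap (fun κ => seg κ (w κ))).take k))))⁻¹ m
                  - R (hol V 0 (treeWord (disp (s.flatMap (fun κ => seg κ (w κ)) ++ seg μ (w μ + 1)) + disp ((t.flatMap (fun κ => seg κ (w κ))).take k))))⁻¹ m
                    * ((hol V (disp (s.flatMap (fun κ => seg κ (w κ)) ++ seg μ (w μ + 1)) + disp ((t.flatMap (fun κ => seg κ (w κ))).take k))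
                      [(t.flatMap (fun κ => seg κ (w κ))).getD k (μ, true), (μ, true), ((t.flatMap (fun κ => seg κ (w κ))).getD k (μ, true)).rev, (μ, false)] : 𝔸ˣ) : 𝔸)‖
            + ∑ k ∈ Finset.range (t.flatMap (fun κ => seg κ (w κ))).length,
                ‖((hol V (disp (s.flatMap (fun κ => seg κ (w κ)) ++ seg μ (w μ)) + disp ((t.flatMap (fun κ => seg κ (w κ))).take k))
                      [(t.flatMap (fun κ => seg κ (w κ))).getD k (μ, true), (μ, true), ((t.flatMap (fun κ => seg κ (w κ))).getD k (μ, true)).rev, (μ, false)] : 𝔸ˣ) : 𝔸)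
                    * R (hol V 0 (treeWord (disp (s.flatMap (fun κ => seg κ (w κ)) ++ seg μ (w μ)) + disp ((t.flatMap (fun κ => seg κ (w κ))).take k))))⁻¹ m
                  - R (hol V 0 (treeWord (disp (s.flatMap (fun κ => seg κ (w κ)) ++ seg μ (w μ)) + disp ((t.flatMap (fun κ => seg κ (w κ))).take k))))⁻¹ m
                    * ((hol V (disp (s.flatMap (fun κ => seg κ (w κ)) ++ seg μ (w μ)) + disp ((t.flatMap (fun κ => seg κ (w κ))).take k))
                      [(t.flatMap (fun κ => seg κ (w κ))).getD k (μ, true), (μ, true), ((t.flatMap (fun κ => seg κ (w κ))).getD k (μ, true)).rev, (μ, false)] : 𝔸ˣ) : 𝔸)‖) := by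
  -- names
  set A : List (Letter d) := s.flatMap (fun κ => seg κ (w κ)) with hA
  set B : List (Letter d) := t.flatMap (fun κ => seg κ (w κ)) with hB
  set n : ℕ := B.length with hn
  set q₁ : Site d := disp (A ++ seg μ (w μ + 1)) with hq₁
  set q₂ : Site d := disp (A ++ seg μ (w μ)) with hq₂
  set 𝒯₁ : 𝔸ˣ := hol V 0 (A ++ seg μ (w μ + 1)) with h𝒯₁
  set 𝒯₂ : 𝔸ˣ := hol V 0 (A ++ seg μ (w μ)) with h𝒯₂
  set β : 𝔸ˣ := V q₂ μ with hβ
  -- the comb at `w + e_μ` has the same `A`, `B` and one more `μ`-step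
  have hAe : s.flatMap (fun κ => seg κ ((w + e μ) κ)) = A := by rw [hA]; exact flatMap_seg_add_e w μ hs
  have hBe : t.flatMap (fun κ => seg κ ((w + e μ) κ)) = B := by rw [hB]; exact flatMap_seg_add_e w μ ht
  have hμe : (w + e μ) μ = w μ + 1 := by rw [Pi.add_apply, B7Prop1Explicit.e_apply, if_pos rfl]
  -- the two contours as conjugated ladders over the SAME prefix `𝒯₁`
  have hq₂' : q₁ - e μ = q₂ := by rw [hq₁, hq₂, disp_base_neg, disp_base_nonneg]
  have h𝒯 : 𝒯₂ = 𝒯₁ * β⁻¹ := by rw [h𝒯₂, h𝒯₁, hβ, ← hq₂', hq₁, hA]; exact hol_prefix_pred V _ μ (w μ)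
  -- the chains
  set T : ℕ → 𝔸ˣ := fun k => hol V q₁ (B.take k) with hT
  set P₁ : ℕ → 𝔸ˣ := fun k => hol V (q₁ + disp (B.take k)) [B.getD k (μ, true), (μ, true), (B.getD k (μ, true)).rev, (μ, false)] with hP₁
  set g : ℕ → 𝔸ˣ := fun k => hol V q₁ (B.take k ++ (μ, true) :: (revWord (B.take k) ++ [(μ, false)])) with hg
  set T'' : ℕ → 𝔸ˣ := fun k => β⁻¹ * hol V q₂ (B.take k) with hT''
  set P₂ : ℕ → 𝔸ˣ := fun k => hol V (q₂ + disp (B.take k)) [B.getD k (μ, true), (μ, true), (B.getD k (μ, true)).rev, (μ, false)] with hP₂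
  set g'' : ℕ → 𝔸ˣ := fun k => β⁻¹ * hol V q₂ (B.take k ++ (μ, true) :: (revWord (B.take k) ++ [(μ, false)])) * β with hg''
  have hbi := bicontr_hol V hV
  have hβb : ‖(β : 𝔸)‖ ≤ 1 ∧ ‖((β⁻¹ : 𝔸ˣ) : 𝔸)‖ ≤ 1 := hV q₂ μ
  have hβb' : ‖((β⁻¹ : 𝔸ˣ) : 𝔸)‖ ≤ 1 ∧ ‖(((β⁻¹)⁻¹ : 𝔸ˣ) : 𝔸)‖ ≤ 1 := by rw [inv_inv]; exact ⟨hβb.2, hβb.1⟩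
  have hTb : ∀ k, ‖(T k : 𝔸)‖ ≤ 1 ∧ ‖(((T k)⁻¹ : 𝔸ˣ) : 𝔸)‖ ≤ 1 := fun k => hbi _ _
  have hP₁b : ∀ k, ‖(P₁ k : 𝔸)‖ ≤ 1 ∧ ‖(((P₁ k)⁻¹ : 𝔸ˣ) : 𝔸)‖ ≤ 1 := fun k => hbi _ _
  have hgb : ∀ k, ‖(g k : 𝔸)‖ ≤ 1 ∧ ‖(((g k)⁻¹ : 𝔸ˣ) : 𝔸)‖ ≤ 1 := fun k => hbi _ _
  have hT''b : ∀ k, ‖(T'' k : 𝔸)‖ ≤ 1 ∧ ‖(((T'' k)⁻¹ : 𝔸ˣ) : 𝔸)‖ ≤ 1 := fun k => by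
    refine ⟨?_, ?_⟩
    · simp only [hT'', Units.val_mul]
      exact (norm_mul_le _ _).trans (by nlinarith [hβb.2, (hbi q₂ (B.take k)).1, norm_nonneg ((β⁻¹ : 𝔸ˣ) : 𝔸), norm_nonneg ((hol V q₂ (B.take k) : 𝔸ˣ) : 𝔸)])
    · simp only [hT'', mul_inv_rev, inv_inv, Units.val_mul]
      exact (norm_mul_le _ _).trans (by nlinarith [hβb.1, (hbi q₂ (B.take k)).2, norm_nonneg (β : 𝔸), norm_nonneg (((hol V q₂ (B.take k))⁻¹ : 𝔸ˣ) : 𝔸)])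
  have hP₂b : ∀ k, ‖(P₂ k : 𝔸)‖ ≤ 1 ∧ ‖(((P₂ k)⁻¹ : 𝔸ˣ) : 𝔸)‖ ≤ 1 := fun k => hbi _ _
  have hg''b : ∀ k, ‖(g'' k : 𝔸)‖ ≤ 1 ∧ ‖(((g'' k)⁻¹ : 𝔸ˣ) : 𝔸)‖ ≤ 1 := fun k => by
    have h1 := bicontr_conj hβb' (hbi q₂ (B.take k ++ (μ, true) :: (revWord (B.take k) ++ [(μ, false)])))
    rw [inv_inv] at h1
    exact h1
  have h0 : g 0 = 1 := by simp only [hg]; exact ladder_chain_zero V q₁ μ B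
  have hstep : ∀ k, g (k + 1) = (T k * P₁ k * (T k)⁻¹) * g k := fun k => by simp only [hg, hT, hP₁]; exact ladder_chain_succ V q₁ μ B k
  have h0'' : g'' 0 = 1 := by simp only [hg'']; rw [ladder_chain_zero V q₂ μ B, mul_one, inv_mul_cancel]
  have hstep'' : ∀ k, g'' (k + 1) = (T'' k * P₂ k * (T'' k)⁻¹) * g'' k := fun k => by
    simp only [hg'', hT'', hP₂]; exact conj_ladder_chain_succ V q₂ μ B β k
  have hPa : ∀ k, ‖(P₁ k : 𝔸) - 1‖ ≤ a := fun k => hplaq _ _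
  have hP'a : ∀ k, ‖(P₂ k : 𝔸) - 1‖ ≤ a := fun k => hplaq _ _
  -- the abstract first-order theorem at `m′ = R(𝒯₁⁻¹) m`
  have main := norm_lapDefect_chain_add_comm_sum_le T P₁ T'' P₂ g g'' hTb hP₁b hgb h0 hstep hT''b hP₂b hg''b h0'' hstep'' ha hPa hP'a (R 𝒯₁⁻¹ m) n
  -- the two loops: `V(contour at w + e_μ) = 𝒯₁ g(n) 𝒯₁⁻¹`, `V(contour at w) = 𝒯₁ g″(n) 𝒯₁⁻¹`
  have hBn : B.take n = B := by rw [hn]; exact List.take_length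
  have hloop₁ : hol V 0 (contour27 0 (w + e μ) μ) = 𝒯₁ * g n * 𝒯₁⁻¹ := by
    rw [hol_contour27_eq_conj_ladder V (w + e μ) μ h hs ht, hAe, hBe, hμe]
    simp only [hg, h𝒯₁, hq₁, hBn]
  have hloop₂ : hol V 0 (contour27 0 w μ) = 𝒯₁ * g'' n * 𝒯₁⁻¹ := by
    have h1 : hol V 0 (contour27 0 w μ) = 𝒯₂ * hol V q₂ (B ++ (μ, true) :: (revWord B ++ [(μ, false)])) * 𝒯₂⁻¹ :=
      hol_contour27_eq_conj_ladder V w μ h hs ht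
    rw [h1, h𝒯]
    simp only [hg'', hBn]
    group
  -- canonical transports: `𝒯₁·T_k = V(Γ_(0, q₁ + disp(B↾k)))`, `𝒯₁·T″_k = 𝒯₂·V_(q₂)(B↾k) = V(Γ_(0, q₂ + disp(B↾k)))`
  have hcan₁ : ∀ k, k ∈ Finset.range n → 𝒯₁ * T k = hol V 0 (treeWord (q₁ + disp (B.take k))) := fun k hk => by
    have hk' : k ≤ (t.flatMap (fun κ => seg κ ((w + e μ) κ))).length := by rw [hBe]; exact (Finset.mem_range.mp hk).le
    have := hol_base_prefix_nonneg V μ h (w + e μ) k hk'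
    rw [hAe, hBe, hμe] at this
    simpa only [h𝒯₁, hT, hq₁] using this
  have hcan₂ : ∀ k, k ∈ Finset.range n → 𝒯₁ * T'' k = hol V 0 (treeWord (q₂ + disp (B.take k))) := fun k hk => by
    have hk' : k ≤ (t.flatMap (fun κ => seg κ (w κ))).length := (Finset.mem_range.mp hk).le
    have := hol_base_prefix_nonneg V μ h w k hk'
    simp only [hT'', ← mul_assoc, ← h𝒯]
    simpa only [h𝒯₂, hq₂, hA, hB] using this
  -- conjugate `main` by `𝒯₁`
  have hK : (𝒯₁ : 𝔸) * ((𝒯₁⁻¹ : 𝔸ˣ) : 𝔸) = 1 := Units.mul_inv 𝒯₁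
  have hK' : ((𝒯₁⁻¹ : 𝔸ˣ) : 𝔸) * (𝒯₁ : 𝔸) = 1 := Units.inv_mul 𝒯₁
  -- (i) the Laplacian summand
  have eLap : (2 : ℕ) • m - R (hol V 0 (contour27 0 w μ))⁻¹ m - R (hol V 0 (contour27 0 (w + e μ) μ)) m
      = R 𝒯₁ ((2 : ℕ) • R 𝒯₁⁻¹ m - R (g'' n)⁻¹ (R 𝒯₁⁻¹ m) - R (g n) (R 𝒯₁⁻¹ m)) := by
    rw [hloop₁, hloop₂, B9Eq39Adjoint.R_sub, B9Eq39Adjoint.R_sub, ← B9Eq39Adjoint.R_mul, ← B9Eq39Adjoint.R_mul, ← B9Eq39Adjoint.R_mul, ← B9Eq39Adjoint.R_mul,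
      two_nsmul, two_nsmul, B9Eq39Adjoint.R_add, B9Eq39Adjoint.R_R_inv]
    congr 2
    rw [mul_inv_rev, mul_inv_rev, inv_inv, mul_assoc]
  -- (ii) the first-order sum
  set Δ : ℕ → 𝔸 := fun k => ((T k * P₁ k * (T k)⁻¹ : 𝔸ˣ) : 𝔸) - ((T'' k * P₂ k * (T'' k)⁻¹ : 𝔸ˣ) : 𝔸) with hΔ
  set D : ℕ → 𝔸 := fun k => R (hol V 0 (treeWord (q₁ + disp (B.take k)))) (P₁ k : 𝔸) - R (hol V 0 (treeWord (q₂ + disp (B.take k)))) (P₂ k : 𝔸) with hD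
  have hΔD : ∀ k ∈ Finset.range n, R 𝒯₁ (Δ k) = D k := fun k hk => by
    simp only [hΔ, hD, ← hcan₁ k hk, ← hcan₂ k hk, R_def, Units.val_mul, mul_inv_rev]
    noncomm_ring
  have eSum : R 𝒯₁ ((∑ k ∈ Finset.range n, Δ k) * R 𝒯₁⁻¹ m - R 𝒯₁⁻¹ m * ∑ k ∈ Finset.range n, Δ k)
      = (∑ k ∈ Finset.range n, D k) * m - m * ∑ k ∈ Finset.range n, D k := by
    rw [← Finset.sum_congr rfl hΔD, ← R_finset_sum]
    set S := ∑ k ∈ Finset.range n, Δ k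
    rw [R_def, R_def, R_def, inv_inv]
    calc (𝒯₁ : 𝔸) * (S * (((𝒯₁⁻¹ : 𝔸ˣ) : 𝔸) * m * (𝒯₁ : 𝔸)) - ((𝒯₁⁻¹ : 𝔸ˣ) : 𝔸) * m * (𝒯₁ : 𝔸) * S) * ((𝒯₁⁻¹ : 𝔸ˣ) : 𝔸)
        = (𝒯₁ : 𝔸) * S * ((𝒯₁⁻¹ : 𝔸ˣ) : 𝔸) * m * ((𝒯₁ : 𝔸) * ((𝒯₁⁻¹ : 𝔸ˣ) : 𝔸)) - ((𝒯₁ : 𝔸) * ((𝒯₁⁻¹ : 𝔸ˣ) : 𝔸)) * m * ((𝒯₁ : 𝔸) * S * ((𝒯₁⁻¹ : 𝔸ˣ) : 𝔸)) := by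
            noncomm_ring
      _ = _ := by rw [hK, mul_one, one_mul]
  -- (iii) assemble: the left side is `R(𝒯₁)` of `main`'s left side
  have eAll : ((2 : ℕ) • m - R (hol V 0 (contour27 0 w μ))⁻¹ m - R (hol V 0 (contour27 0 (w + e μ) μ)) m)
        + ((∑ k ∈ Finset.range n, D k) * m - m * ∑ k ∈ Finset.range n, D k)
      = R 𝒯₁ (((2 : ℕ) • R 𝒯₁⁻¹ m - R (g'' n)⁻¹ (R 𝒯₁⁻¹ m) - R (g n) (R 𝒯₁⁻¹ m))
          + ((∑ k ∈ Finset.range n, Δ k) * R 𝒯₁⁻¹ m - R 𝒯₁⁻¹ m * ∑ k ∈ Finset.range n, Δ k)) := by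
    rw [B9Eq39Adjoint.R_add, ← eLap, ← eSum]
  have h𝒯b : ‖(𝒯₁ : 𝔸)‖ ≤ 1 ∧ ‖((𝒯₁⁻¹ : 𝔸ˣ) : 𝔸)‖ ≤ 1 := hbi _ _
  -- the two rung families of `main` in canonical letters
  set N₁ : ℕ → ℝ := fun k => ‖(P₁ k : 𝔸) * R (hol V 0 (treeWord (q₁ + disp (B.take k))))⁻¹ m - R (hol V 0 (treeWord (q₁ + disp (B.take k))))⁻¹ m * (P₁ k : 𝔸)‖ with hN₁
  set N₂ : ℕ → ℝ := fun k => ‖(P₂ k : 𝔸) * R (hol V 0 (treeWord (q₂ + disp (B.take k))))⁻¹ m - R (hol V 0 (treeWord (q₂ + disp (B.take k))))⁻¹ m * (P₂ k : 𝔸)‖ with hN₂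
  have hS₁ : ∑ k ∈ Finset.range n, ‖(P₁ k : 𝔸) * R (T k)⁻¹ (R 𝒯₁⁻¹ m) - R (T k)⁻¹ (R 𝒯₁⁻¹ m) * (P₁ k : 𝔸)‖ = ∑ k ∈ Finset.range n, N₁ k :=
    Finset.sum_congr rfl fun k hk => by simp only [hN₁]; rw [← B9Eq39Adjoint.R_mul, ← mul_inv_rev, hcan₁ k hk]
  have hS₂ : ∑ k ∈ Finset.range n, ‖(P₂ k : 𝔸) * R (T'' k)⁻¹ (R 𝒯₁⁻¹ m) - R (T'' k)⁻¹ (R 𝒯₁⁻¹ m) * (P₂ k : 𝔸)‖ = ∑ k ∈ Finset.range n, N₂ k :=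
    Finset.sum_congr rfl fun k hk => by simp only [hN₂]; rw [← B9Eq39Adjoint.R_mul, ← mul_inv_rev, hcan₂ k hk]
  rw [hS₁, hS₂] at main
  have final := (norm_R_le h𝒯b _).trans main
  rw [← eAll] at final
  exact final

end Normed

end Summit.QuantumFields.YangMills.Theorems.Prop7LapCombFirstOrder

end
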